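import Summits.QuantumFields.YangMills.Theorems.FluctuationComparisonRegPrIntLELetterExtraction
import HarnessLib

/-!
# S1a · THE ᴱ-EDITION OF THE CUT-HEIGHT DOMINATION STEP (✓p828170 `mem_of_dominated` → v19 «BACKGROUND WINDOWS»): `Φ_m` OF THE RUN DENSITY +
# DOMINATION `ρᵗ ≤ e^Δ·ρᶜ` AT BACKGROUND-SMALL DATA ⟹ `Φ_m` OF THE CUT DENSITY with slack `+ Δ`

Cell `ym3-torus` (YM ladder rung R3 = continuum `SU(2)` Yang–Mills on the three-torus — a RUNG: NOT d = 4, NOT infinite volume, NOT a mass gap, NOT Clay).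
Width seat «width 8» `ym3-torus-px8` (gen 25), FREE px helper on crux `stmt-QuantumFields-20520`, count-neutral, DEFINITION-FREE, default heartbeats.

WHY.  UV3-NODE §69.17 (this seat): the letter `hdom_j` of ✓p828170∕✓p828515 («`ρᵗ ≤ e^{Δ_j}·ρᶜ` on the WHOLE datum window `PlaqSmall δ_j`») is
UNSATISFIABLE for the line's (½, 24∕25) cut at `L = 3` (the one-step fibre over rough 2×-window data is empty).  LEAD w3 g28 RULING №60∕№61 and ★★OWNER
RULING №105 adopted repair (E) «windows ON THE BACKGROUND» ([Balaban1985UV3] (47) p.267: `χ_k` constrains the FINE plaquettes of `U_k(V)`): the (m) conjunct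
becomes the def-free letter `Φ_m` (this seat's v1.2 text, in the tree via ✓`…ELetterExtraction`), whose `lower`∕`upper`∕`act_bound` are demanded only at data whose
background is fine-small.  THERE the domination road of §67.3 (m3) revives with the RIGHT letter: `hdomBG_j` — «the run density exceeds the cut density by
at most `e^{Δ_j}` at data admitting a regular minimiser with fine plaquettes `< δ_j·L^{−2(K−j)}`» — PLAUSIBLE under (E) (a background-small datum's averages
sit inside the cut with margin `0.115·θ_{j+1}` at `L = 3`, §69.17-A (4)); its supplier is the one-step small-field CONCENTRATION of the fibre law inside the cut
((47)'s mechanism, [Balaban1987RG1] small-field dominance) — NOT a printed sentence; displayed, not discharged.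

WHAT.  ★★★ `phiM_of_dominated_bg` — for a run `K ≥ j`, a schedule `prm`, the run's height-`j` density `ρᵗ` with `Φ_m(K, hjK, prm j, ρᵗ)`, and a second
density `ρᶜ` (the CUT tower's) that is measurable, gauge invariant, `0 ≤ ρᶜ ≤ ρᵗ`, and dominated on the background window (`hdomBG`, `0 ≤ Δ`):
`Φ_m(K, hjK, ·, ρᶜ)` with the SAME witness data and the two `(prm j).slack` tokens reading `((prm j).slack + Δ)` — a consumer whose schedule is
`{prm j with slack := (prm j).slack + Δ j}` (admissible by ✓`…S1aMemOfDominated.admissible_add_slack` for `Δ_j ≤ S₁q₁^j`) docks by `exact`.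
Proof = ✓p828170's on the unfolded `∃`: `lower` from `Φ_m(ρᵗ).lower` and `hdomBG` (both premises of the re-lettered `lower` are exactly `hdomBG`'s;
the witness `bg V` is the regular minimiser it asks for), `upper`∕`large` from `ρᶜ ≤ ρᵗ` and `0 ≤ Δ`, measurability∕invariance of the reading from
`ρᶜ`'s (lit `measurable_readAtLevel`, `fieldShift_gaugeAct`).  Sorry-free, axioms standard.

HONEST: a door between HYPOTHESIS letters; `hdomBG_j` is NEW and UNDISCHARGED; nothing of Bałaban's renormalisation-group analysis is asserted or proved;
(m) AS TYPED suspect-false at `L = 3` (§69.17, GUIDANCE), (m)_E OPEN; the five registered stubs (3732b7df) ∕ 20520 ∕ 19936 ∕ 19200 ∕ `YM3TorusSU2` NOT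
proved; rung R3 = SU(2) YM₃ on T³ — NOT d = 4, NOT infinite volume, NOT a mass gap, NOT Clay.
-/

set_option autoImplicit false

noncomputable section

namespace Summit.QuantumFields.YangMills.Theorems.FluctuationComparisonRegPrIntLS1aPhiMOfDominatedBG

open MeasureTheory
open Literature.MathematicalPhysics.QuantumFieldTheory
open Literature.MathematicalPhysics.QuantumFieldTheory.Balaban1983to89
open Literature.MathematicalPhysics.QuantumFieldTheory.Balaban1983to89.T3ContinuumYM3Torus
open Literature.MathematicalPhysics.QuantumFieldTheory.Balaban1983to89.T3UnitLawDensityEML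
open Literature.MathematicalPhysics.QuantumFieldTheory.Balaban1983to89.T3LevelShift
open Literature.MathematicalPhysics.QuantumFieldTheory.Balaban1983to89.B5Eq118OneStroke (iterBlockOf)
open Literature.MathematicalPhysics.QuantumFieldTheory.Balaban1983to89.BalabanUVClass

variable (F : T3Family)

/-- ★★★ **Φ_m OF THE RUN DENSITY + DOMINATION ON THE BACKGROUND WINDOW ⟹ Φ_m OF THE CUT DENSITY (slack `+ Δ`).**  Hypotheses: `hm` = the v19 letter
`Φ_m(K, hjK, prm j, ρᵗ)` verbatim; `hcm`∕`hcinv`∕`hc0`∕`hle` = the cut density is measurable, gauge invariant, `0 ≤ ρᶜ ≤ ρᵗ` (✓p828170 `cutTower_le_run` +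
`density_le_of_withDensity_le`, ✓p829409 for invariance); `hdomBG` = THE NEW LETTER, asked only at data `V` in the datum window that admit a regular
minimiser `U₀` (lit `IsBackground`) with fine plaquettes `< (prm j).δ·((F.L)⁻¹)^(2(K−j))`.  Conclusion: the letter `Φ_m` for `ρᶜ` with the two slack
tokens `((prm j).slack + Δ)`.  Nothing of Bałaban's asserted. [cite: Balaban1985UV3, (41)-(47) pp.266-267] -/
theorem phiM_of_dominated_bg {j K : ℕ} (hjK : j ≤ K) (prm : ℕ → ClassParams)
    (ρt ρc : GaugeField (F.P j) 0 (Matrix.specialUnitaryGroup (Fin 2) ℂ) → ℝ) {Δ : ℝ} (hΔ : 0 ≤ Δ)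
    (hm :
        ∃ κ : ℝ, ∃ (bg : GaugeField (F.P K) (K - j) (Matrix.specialUnitaryGroup (Fin 2) ℂ) → GaugeField (F.P K) 0 (Matrix.specialUnitaryGroup (Fin 2) ℂ))
          (nDom : ℕ) (supp : Fin nDom → Set (PBond (F.P K) 0)) (foot : Fin nDom → Finset (Site (F.P K) (K - j)))
          (len : Fin nDom → ℝ) (wt : Fin nDom → ℝ) (act : Fin nDom → GaugeField (F.P K) 0 (Matrix.specialUnitaryGroup (Fin 2) ℂ) → ℝ)
          (cst : ℝ) (lf : GaugeField (F.P K) (K - j) (Matrix.specialUnitaryGroup (Fin 2) ℂ) → ℝ),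
          (∀ V, 0 ≤ readAtLevel F hjK (fun U => Real.exp κ * ρt U) V) ∧
          Measurable (readAtLevel F hjK (fun U => Real.exp κ * ρt U)) ∧
          GaugeField.GaugeInvariant (readAtLevel F hjK (fun U => Real.exp κ * ρt U)) ∧
          (∀ V, PlaqSmall (prm j).δ V →
            IsBackground (fun i => BlockAveraging.blockAvg (P := F.P K) (j := i) ℰp) {U | PlaqSmall (prm j).δreg U} (K - j) V (bg V)) ∧
          (∀ X, (foot X).Nonempty) ∧ (∀ X b, b ∈ supp X → iterBlockOf (K - j) b.src ∈ foot X) ∧ (∀ X, 0 ≤ len X) ∧ (∀ X, 0 ≤ wt X) ∧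
          (∀ X, ∀ y ∈ foot X, ∀ y' ∈ foot X, (Site.tdist y y' : ℝ) ≤ (prm j).M * (len X + 1)) ∧
          (∀ X (U U' : GaugeField (F.P K) 0 (Matrix.specialUnitaryGroup (Fin 2) ℂ)), (∀ b ∈ supp X, U b = U' b) → act X U = act X U') ∧
          (∀ X, GaugeField.GaugeInvariant (act X)) ∧
          (∀ X V, PlaqSmall (prm j).δ V → PlaqSmall ((prm j).δ * ((F.L : ℝ)⁻¹) ^ (2 * (K - j))) (bg V) →
            |act X (bg V)| ≤ wt X * Real.exp (-((prm j).κ * len X))) ∧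
          (∀ y : Site (F.P K) (K - j), ∑ X ∈ Finset.univ.filter (fun X => y ∈ foot X), wt X * Real.exp (-((prm j).κ * len X)) ≤ (prm j).Ccov) ∧
          |cst| ≤ (prm j).cE * Fintype.card (Site (F.P K) (K - j)) ∧
          (∀ V, PlaqSmall (prm j).δ V → PlaqSmall ((prm j).δ * ((F.L : ℝ)⁻¹) ^ (2 * (K - j))) (bg V) →
            Real.exp (-((prm j).β * wilsonAction4 (bg V)) + (∑ X, act X (bg V)) + cst - (prm j).slack) ≤ readAtLevel F hjK (fun U => Real.exp κ * ρt U) V) ∧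
          (∀ V, PlaqSmall (prm j).δ V → PlaqSmall ((prm j).δ * ((F.L : ℝ)⁻¹) ^ (2 * (K - j))) (bg V) →
            readAtLevel F hjK (fun U => Real.exp κ * ρt U) V ≤ Real.exp (-((prm j).β * wilsonAction4 (bg V)) + (∑ X, act X (bg V)) + cst + (prm j).slack) + lf V) ∧
          (∀ V, 0 ≤ lf V) ∧ (∀ V, lf V ≤ Real.exp (-(prm j).cLF) * Real.exp ((prm j).c5 * Fintype.card (Site (F.P K) (K - j)))) ∧
          (∀ V (S : Finset (Plaq (F.P K) (K - j))), (∀ p ∈ S, (prm j).δL ≤ dist1 (GaugeField.plaqHol V p)) →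
            readAtLevel F hjK (fun U => Real.exp κ * ρt U) V ≤ Real.exp (-((prm j).cLF * S.card)) * Real.exp ((prm j).c5 * Fintype.card (Site (F.P K) (K - j)))))
    (hcm : Measurable ρc) (hcinv : GaugeField.GaugeInvariant ρc) (hc0 : ∀ V, 0 ≤ ρc V) (hle : ∀ V, ρc V ≤ ρt V)
    (hdomBG : ∀ V : GaugeField (F.P K) (K - j) (Matrix.specialUnitaryGroup (Fin 2) ℂ), PlaqSmall (prm j).δ V →
      (∃ U₀ : GaugeField (F.P K) 0 (Matrix.specialUnitaryGroup (Fin 2) ℂ),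
          IsBackground (fun i => BlockAveraging.blockAvg (P := F.P K) (j := i) ℰp) {U | PlaqSmall (prm j).δreg U} (K - j) V U₀ ∧
          PlaqSmall ((prm j).δ * ((F.L : ℝ)⁻¹) ^ (2 * (K - j))) U₀) →
      readAtLevel F hjK ρt V ≤ Real.exp Δ * readAtLevel F hjK ρc V) :
    ∃ κ : ℝ, ∃ (bg : GaugeField (F.P K) (K - j) (Matrix.specialUnitaryGroup (Fin 2) ℂ) → GaugeField (F.P K) 0 (Matrix.specialUnitaryGroup (Fin 2) ℂ))
      (nDom : ℕ) (supp : Fin nDom → Set (PBond (F.P K) 0)) (foot : Fin nDom → Finset (Site (F.P K) (K - j)))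
      (len : Fin nDom → ℝ) (wt : Fin nDom → ℝ) (act : Fin nDom → GaugeField (F.P K) 0 (Matrix.specialUnitaryGroup (Fin 2) ℂ) → ℝ)
      (cst : ℝ) (lf : GaugeField (F.P K) (K - j) (Matrix.specialUnitaryGroup (Fin 2) ℂ) → ℝ),
      (∀ V, 0 ≤ readAtLevel F hjK (fun U => Real.exp κ * ρc U) V) ∧
      Measurable (readAtLevel F hjK (fun U => Real.exp κ * ρc U)) ∧
      GaugeField.GaugeInvariant (readAtLevel F hjK (fun U => Real.exp κ * ρc U)) ∧
      (∀ V, PlaqSmall (prm j).δ V →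
        IsBackground (fun i => BlockAveraging.blockAvg (P := F.P K) (j := i) ℰp) {U | PlaqSmall (prm j).δreg U} (K - j) V (bg V)) ∧
      (∀ X, (foot X).Nonempty) ∧ (∀ X b, b ∈ supp X → iterBlockOf (K - j) b.src ∈ foot X) ∧ (∀ X, 0 ≤ len X) ∧ (∀ X, 0 ≤ wt X) ∧
      (∀ X, ∀ y ∈ foot X, ∀ y' ∈ foot X, (Site.tdist y y' : ℝ) ≤ (prm j).M * (len X + 1)) ∧
      (∀ X (U U' : GaugeField (F.P K) 0 (Matrix.specialUnitaryGroup (Fin 2) ℂ)), (∀ b ∈ supp X, U b = U' b) → act X U = act X U') ∧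
      (∀ X, GaugeField.GaugeInvariant (act X)) ∧
      (∀ X V, PlaqSmall (prm j).δ V → PlaqSmall ((prm j).δ * ((F.L : ℝ)⁻¹) ^ (2 * (K - j))) (bg V) →
        |act X (bg V)| ≤ wt X * Real.exp (-((prm j).κ * len X))) ∧
      (∀ y : Site (F.P K) (K - j), ∑ X ∈ Finset.univ.filter (fun X => y ∈ foot X), wt X * Real.exp (-((prm j).κ * len X)) ≤ (prm j).Ccov) ∧
      |cst| ≤ (prm j).cE * Fintype.card (Site (F.P K) (K - j)) ∧
      (∀ V, PlaqSmall (prm j).δ V → PlaqSmall ((prm j).δ * ((F.L : ℝ)⁻¹) ^ (2 * (K - j))) (bg V) →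
        Real.exp (-((prm j).β * wilsonAction4 (bg V)) + (∑ X, act X (bg V)) + cst - ((prm j).slack + Δ)) ≤ readAtLevel F hjK (fun U => Real.exp κ * ρc U) V) ∧
      (∀ V, PlaqSmall (prm j).δ V → PlaqSmall ((prm j).δ * ((F.L : ℝ)⁻¹) ^ (2 * (K - j))) (bg V) →
        readAtLevel F hjK (fun U => Real.exp κ * ρc U) V ≤ Real.exp (-((prm j).β * wilsonAction4 (bg V)) + (∑ X, act X (bg V)) + cst + ((prm j).slack + Δ)) + lf V) ∧
      (∀ V, 0 ≤ lf V) ∧ (∀ V, lf V ≤ Real.exp (-(prm j).cLF) * Real.exp ((prm j).c5 * Fintype.card (Site (F.P K) (K - j)))) ∧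
      (∀ V (S : Finset (Plaq (F.P K) (K - j))), (∀ p ∈ S, (prm j).δL ≤ dist1 (GaugeField.plaqHol V p)) →
        readAtLevel F hjK (fun U => Real.exp κ * ρc U) V ≤ Real.exp (-((prm j).cLF * S.card)) * Real.exp ((prm j).c5 * Fintype.card (Site (F.P K) (K - j)))) := by
  obtain ⟨κ, bg, nDom, supp, foot, len, wt, act, cst, lf, _h0, _hmeas, _hinv, hbg, hne, hsf, hlen, hwt, hdiam, hloc, hactinv, hactb,
    hcov, hcst, hlow, hup, hlf0, hlfle, hlarge⟩ := hm
  -- pointwise domination of the readings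
  have hle' : ∀ V : GaugeField (F.P K) (K - j) (Matrix.specialUnitaryGroup (Fin 2) ℂ),
      readAtLevel F hjK (fun U => Real.exp κ * ρc U) V ≤ readAtLevel F hjK (fun U => Real.exp κ * ρt U) V := fun V => by
    rw [readAtLevel_apply, readAtLevel_apply]
    exact mul_le_mul_of_nonneg_left (hle _) (Real.exp_nonneg _)
  refine ⟨κ, bg, nDom, supp, foot, len, wt, act, cst, lf, ?_, ?_, ?_, hbg, hne, hsf, hlen, hwt, hdiam, hloc, hactinv, hactb, hcov, hcst,
    ?_, ?_, hlf0, hlfle, ?_⟩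
  · -- nonneg
    intro V
    rw [readAtLevel_apply]
    exact mul_nonneg (Real.exp_nonneg _) (hc0 _)
  · -- measurable
    exact measurable_readAtLevel F hjK (measurable_const.mul hcm)
  · -- gauge invariance of the reading, from `hcinv` through `fieldShift`
    intro u W
    rw [readAtLevel_apply, readAtLevel_apply]
    exact congrArg (fun x => Real.exp κ * x) ((congrArg ρc (fieldShift_gaugeAct (heightShift_eq F hjK) u W)).trans (hcinv _ _))
  · -- lower: Φ_m(ρᵗ).lower at (V, bg-small), then the domination letter at the witness background
    intro V hV hbgV
    have h1 := hlow V hV hbgV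
    have h2 := hdomBG V hV ⟨bg V, hbg V hV, hbgV⟩
    rw [readAtLevel_apply] at h1 ⊢
    rw [readAtLevel_apply, readAtLevel_apply] at h2
    have hsplit : -((prm j).β * wilsonAction4 (bg V)) + (∑ X, act X (bg V)) + cst - ((prm j).slack + Δ) =
        (-((prm j).β * wilsonAction4 (bg V)) + (∑ X, act X (bg V)) + cst - (prm j).slack) + (-Δ) := by ring
    rw [hsplit, Real.exp_add]
    calc Real.exp (-((prm j).β * wilsonAction4 (bg V)) + (∑ X, act X (bg V)) + cst - (prm j).slack) * Real.exp (-Δ)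
        ≤ (Real.exp κ * ρt _) * Real.exp (-Δ) := mul_le_mul_of_nonneg_right h1 (Real.exp_nonneg _)
      _ ≤ (Real.exp κ * (Real.exp Δ * ρc _)) * Real.exp (-Δ) :=
          mul_le_mul_of_nonneg_right (mul_le_mul_of_nonneg_left h2 (Real.exp_nonneg _)) (Real.exp_nonneg _)
      _ = Real.exp κ * ρc _ * (Real.exp Δ * Real.exp (-Δ)) := by ring
      _ = Real.exp κ * ρc _ := by rw [← Real.exp_add, add_neg_cancel, Real.exp_zero, mul_one]
  · -- upper: ρᶜ ≤ ρᵗ, then Φ_m(ρᵗ).upper, then slack ≤ slack + Δ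
    intro V hV hbgV
    have h1 := hup V hV hbgV
    have hmono : Real.exp (-((prm j).β * wilsonAction4 (bg V)) + (∑ X, act X (bg V)) + cst + (prm j).slack) ≤
        Real.exp (-((prm j).β * wilsonAction4 (bg V)) + (∑ X, act X (bg V)) + cst + ((prm j).slack + Δ)) :=
      Real.exp_le_exp.mpr (by linarith)
    exact (hle' V).trans (h1.trans (by linarith))
  · -- large: ρᶜ ≤ ρᵗ
    intro V S hS
    exact (hle' V).trans (hlarge V S hS)

end Summit.QuantumFields.YangMills.Theorems.FluctuationComparisonRegPrIntLS1aPhiMOfDominatedBG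

end
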